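import Mathlib

/-!
# Barrier-SQP for discrete-time optimal control: oracle-use counts of the quantum Schur step,
# the stage structure of the Schur complement, and the read-out counting skeleton (DEQ-A163)

Instance-level adjudication of specific advantage claims; no claim about BQP vs BPP or the
summit.

Source under adjudication: N. B. Dehaghani, R. Wisniewski, A. P. Aguiar, *Quantum-Assisted
Barrier Sequential Quadratic Programming for Nonlinear Optimal Control*, arXiv:2510.18116v1 =
IEEE Control Systems Letters 9 (2025) 3005–3010: Algorithm 2 (quantum Schur step
`U_{Q⁻¹} ← QSVT-Invert(U_Q)`, `U_S ← U_𝒜 · U_{Q⁻¹} · U_𝒜ᵀ`, `U_b ← −U_r − U_𝒜 U_{Q⁻¹} U_g`,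
`U_{S⁻¹} ← QSVT-Invert(U_S)`, `U_λ ← U_{S⁻¹} U_b`, `U_1 ← U_g + U_𝒜ᵀ U_λ`,
`U_{Δz} ← −U_{Q⁻¹} U_1`, then 'Conducting measurements on U_{Δz} to obtain Δz'),
Proposition 1 (normalisation factor `α_{Δz}`), Remark 5 (`P_succ = ‖Δz‖² / α_{Δz}²`),
Proposition 3 / Theorem 3 (claimed cost polylogarithmic in the number of decision variables
`n_z` against a classical `O(n_z³)`).

This file kernel-checks the elementary facts on which DEQ-A163 rests.

* §1  Algorithm 2 as a term over the four input encodings (Lemma A163-3).  `uses t x` counts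
      the copies of the input encoding `U_x` inside the circuit `t` (products and LCU
      combinations add the counts of their factors, a degree-`d` QSVT inversion uses its
      argument `d` times).  For the output encoding `Udz`:
      `uses = d_Q · (d_S + 2)` copies of `U_Q`, `2 d_S + 2` of `U_𝒜`, `2` of `U_g`, `1` of `U_r`
      (`uses_Udz_Q`, `uses_Udz_A`, `uses_Udz_g`, `uses_Udz_r`) — the two inversion degrees
      MULTIPLY.  `alpha` propagates normalisation factors by the rules of the paper's proof of
      Prop. 1 (product multiplies, LCU adds, inversion of `U_X` gives `κ_X β_X / α_X`);
      `alpha_Udz` is the printed closed form, `alpha_Udz_expanded` the expanded form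
      `κ_Q β_Q α_g/α_Q + κ_S β_S α_r/α_𝒜 + κ_Q κ_S β_Q β_S α_g/α_Q`, and `alpha_Udz_ge` the lower
      bound `α_{Δz} ≥ κ_Q κ_S β_Q β_S α_g / α_Q` behind the success-probability estimate of
      Lemma A163-3(b).
* §2  Stage structure (Theorem A163-4, structural part).  If every row `i` of `𝒜` has a stage
      `σ i`, every column `j` a stage `τ j`, `𝒜 i j ≠ 0` only when `τ j ∈ {σ i, σ i − 1}` and `D`
      couples only columns of equal stage, then `(𝒜 · D · 𝒜ᵀ) i i' ≠ 0` forces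
      `|σ i − σ i'| ≤ 1`: the Schur complement `S = 𝒜 Q⁻¹ 𝒜ᵀ` of the paper's QP subproblem
      (block-diagonal `Q`, dynamics coupling consecutive stages only) is block tridiagonal
      (`schur_stage_banded`), over any semiring.
* §3  Read-out counting skeleton (Lemma A163-2).  If `b` measured bits determine which of the
      candidates in a finite set `C` was encoded, then `|C| ≤ 2^b` (`readout_counting`).
* §4  Diagonal sandwich (Lemma A163-5).  If `t·I ≼ Q ≼ T·I` then `t ≤ Q j j ≤ T` for every `j`
      (`le_diag_of_posSemidef`, `diag_le_of_posSemidef`); hence any spectral interval of the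
      barrier Hessian has ratio at least `Q j j / Q i i`, which is of order `1/μ` at an active
      inequality constraint.

Nothing here is specific to quantum computation.  No `sorry`, no new axioms.
-/

namespace Summit.QuantumAdvantage.Dequantization.SchurStage

open scoped Matrix

/-! ## §1  Algorithm 2 as a term: oracle uses and normalisation -/

/-- the four classical inputs of Algorithm 2, each supplied as a block encoding -/
inductive Sym | Q | A | g | r
  deriving DecidableEq

/-- circuits built from the input encodings by the operations Algorithm 2 uses: product of block
encodings, LCU combination, sign, transpose, and QSVT inversion with a degree-`d` polynomial and
parameters `κ`, `β` (Remark 4 / Prop. 1 of the source) -/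
inductive Term
  | prim : Sym → Term
  | mul : Term → Term → Term
  | add : Term → Term → Term
  | neg : Term → Term
  | tr : Term → Term
  | inv : ℕ → ℝ → ℝ → Term → Term

/-- number of copies of the input encoding `U_x` inside the circuit -/
def uses : Term → Sym → ℕ
  | .prim s, x => if s = x then 1 else 0
  | .mul a b, x => uses a x + uses b x
  | .add a b, x => uses a x + uses b x
  | .neg a, x => uses a x
  | .tr a, x => uses a x
  | .inv d _ _ a, x => d * uses a x

/-- normalisation factor, propagated by the rules of the proof of Prop. 1 -/
noncomputable def alpha (αQ αA αg αr : ℝ) : Term → ℝ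
  | .prim .Q => αQ
  | .prim .A => αA
  | .prim .g => αg
  | .prim .r => αr
  | .mul a b => alpha αQ αA αg αr a * alpha αQ αA αg αr b
  | .add a b => alpha αQ αA αg αr a + alpha αQ αA αg αr b
  | .neg a => alpha αQ αA αg αr a
  | .tr a => alpha αQ αA αg αr a
  | .inv _ κ β a => κ * β / alpha αQ αA αg αr a

section Algorithm2

variable (dQ dS : ℕ) (κQ βQ κS βS : ℝ)

/-- `U_{Q⁻¹} ← QSVT-Invert(U_Q)` -/
def UQinv : Term := .inv dQ κQ βQ (.prim .Q)
/-- `U_S ← U_𝒜 · U_{Q⁻¹} · U_𝒜ᵀ` -/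
def US : Term := .mul (.mul (.prim .A) (UQinv dQ κQ βQ)) (.tr (.prim .A))
/-- `U_b ← −U_r − U_𝒜 U_{Q⁻¹} U_g` -/
def Ub : Term := .add (.neg (.prim .r)) (.neg (.mul (.mul (.prim .A) (UQinv dQ κQ βQ)) (.prim .g)))
/-- `U_{S⁻¹} ← QSVT-Invert(U_S)` -/
def USinv : Term := .inv dS κS βS (US dQ κQ βQ)
/-- `U_λ ← U_{S⁻¹} U_b` -/
def Ulam : Term := .mul (USinv dQ dS κQ βQ κS βS) (Ub dQ κQ βQ)
/-- `U_1 ← U_g + U_𝒜ᵀ U_λ` -/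
def U1 : Term := .add (.prim .g) (.mul (.tr (.prim .A)) (Ulam dQ dS κQ βQ κS βS))
/-- `U_{Δz} ← −U_{Q⁻¹} U_1` -/
def Udz : Term := .neg (.mul (UQinv dQ κQ βQ) (U1 dQ dS κQ βQ κS βS))

/-- copies of `U_Q` in `U_{Δz}`: the two inversion degrees multiply, `d_Q (d_S + 2)`. -/
theorem uses_Udz_Q : uses (Udz dQ dS κQ βQ κS βS) .Q = dQ * (dS + 2) := by
  simp [Udz, U1, Ulam, USinv, Ub, US, UQinv, uses]; ring

/-- copies of `U_𝒜` in `U_{Δz}`: `2 d_S + 2`. -/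
theorem uses_Udz_A : uses (Udz dQ dS κQ βQ κS βS) .A = 2 * dS + 2 := by
  simp [Udz, U1, Ulam, USinv, Ub, US, UQinv, uses]; ring

/-- copies of `U_g` in `U_{Δz}`: `2`. -/
theorem uses_Udz_g : uses (Udz dQ dS κQ βQ κS βS) .g = 2 := by
  simp [Udz, U1, Ulam, USinv, Ub, US, UQinv, uses]

/-- copies of `U_r` in `U_{Δz}`: `1`. -/
theorem uses_Udz_r : uses (Udz dQ dS κQ βQ κS βS) .r = 1 := by
  simp [Udz, U1, Ulam, USinv, Ub, US, UQinv, uses]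

/-- the inversion degrees multiply: already for `d_S ≥ 1` the output holds more than `d_Q · d_S`
copies of `U_Q` -/
theorem dQ_mul_dS_lt_uses : dQ * dS < uses (Udz dQ dS κQ βQ κS βS) .Q ∨ dQ = 0 := by
  rw [uses_Udz_Q]
  rcases Nat.eq_zero_or_pos dQ with h | h
  · exact Or.inr h
  · left; nlinarith

variable (αQ αA αg αr : ℝ)

/-- Prop. 1 of the source, as printed -/
theorem alpha_Udz (hQ : αQ ≠ 0) (hA : αA ≠ 0) (hκ : κQ ≠ 0) (hβ : βQ ≠ 0) :
    alpha αQ αA αg αr (Udz dQ dS κQ βQ κS βS) =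
      κQ * βQ / αQ * (αg + αA * (κS * βS / αA ^ 2) * (αQ / (κQ * βQ)) *
        (αr + αA * (κQ * βQ / αQ) * αg)) := by
  simp only [Udz, U1, Ulam, USinv, Ub, US, UQinv, alpha]
  field_simp

/-- the same factor, expanded -/
theorem alpha_Udz_expanded (hQ : αQ ≠ 0) (hA : αA ≠ 0) (hκ : κQ ≠ 0) (hβ : βQ ≠ 0) :
    alpha αQ αA αg αr (Udz dQ dS κQ βQ κS βS) =
      κQ * βQ * αg / αQ + κS * βS * αr / αA + κQ * κS * βQ * βS * αg / αQ := by
  rw [alpha_Udz dQ dS κQ βQ κS βS αQ αA αg αr hQ hA hκ hβ]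
  field_simp
  ring

/-- lower bound used in Lemma A163-3(b): with Remark 5, `P_succ = ‖Δz‖²/α_{Δz}²` is at most
`‖Δz‖² α_Q² / (κ_Q κ_S β_Q β_S α_g)²` -/
theorem alpha_Udz_ge (hQ : 0 < αQ) (hA : 0 < αA) (hκ : 0 < κQ) (hβ : 0 < βQ) (hκS : 0 ≤ κS)
    (hβS : 0 ≤ βS) (hg : 0 ≤ αg) (hr : 0 ≤ αr) :
    κQ * κS * βQ * βS * αg / αQ ≤ alpha αQ αA αg αr (Udz dQ dS κQ βQ κS βS) := by
  rw [alpha_Udz_expanded dQ dS κQ βQ κS βS αQ αA αg αr hQ.ne' hA.ne' hκ.ne' hβ.ne']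
  have h1 : 0 ≤ κQ * βQ * αg / αQ := by positivity
  have h2 : 0 ≤ κS * βS * αr / αA := by positivity
  linarith

end Algorithm2

/-! ## §2  Stage structure: `𝒜 · D · 𝒜ᵀ` is block tridiagonal -/

/-- Theorem A163-4 (structural part).  Rows of `𝒜` carry a stage `σ`, columns a stage `τ`;
`𝒜` couples row-stage `a` only to column-stages `a` and `a − 1` (the constraint
`x_{k+1} = f(x_k, u_k)` linearised: row block `k+1` touches `z_k` and `z_{k+1}`; row block `0`
touches `z_0`), and `D` (here `Q⁻¹`, block diagonal) couples only columns of equal stage.  Then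
the `(i, i')` entry of `𝒜 D 𝒜ᵀ` vanishes unless the row stages differ by at most one. -/
theorem schur_stage_banded {ι κ R : Type*} [Fintype κ] [NonUnitalNonAssocSemiring R]
    (𝒜 : Matrix ι κ R) (D : Matrix κ κ R) (σ : ι → ℕ) (τ : κ → ℕ)
    (h𝒜 : ∀ i j, 𝒜 i j ≠ 0 → τ j = σ i ∨ τ j + 1 = σ i)
    (hD : ∀ j j', D j j' ≠ 0 → τ j = τ j')
    (i i' : ι) (h : (𝒜 * D * 𝒜ᵀ) i i' ≠ 0) : σ i ≤ σ i' + 1 ∧ σ i' ≤ σ i + 1 := by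
  rw [Matrix.mul_apply] at h
  obtain ⟨j', -, hj'⟩ := Finset.exists_ne_zero_of_sum_ne_zero h
  have h1 := left_ne_zero_of_mul hj'
  have h2 := right_ne_zero_of_mul hj'
  rw [Matrix.transpose_apply] at h2
  rw [Matrix.mul_apply] at h1
  obtain ⟨j, -, hj⟩ := Finset.exists_ne_zero_of_sum_ne_zero h1
  have e1 := h𝒜 i j (left_ne_zero_of_mul hj)
  have e2 := hD j j' (right_ne_zero_of_mul hj)
  have e3 := h𝒜 i' j' h2
  omega

/-- in particular entries two or more stages apart vanish -/
theorem schur_stage_zero {ι κ R : Type*} [Fintype κ] [NonUnitalNonAssocSemiring R]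
    (𝒜 : Matrix ι κ R) (D : Matrix κ κ R) (σ : ι → ℕ) (τ : κ → ℕ)
    (h𝒜 : ∀ i j, 𝒜 i j ≠ 0 → τ j = σ i ∨ τ j + 1 = σ i)
    (hD : ∀ j j', D j j' ≠ 0 → τ j = τ j')
    (i i' : ι) (hfar : σ i' + 2 ≤ σ i ∨ σ i + 2 ≤ σ i') : (𝒜 * D * 𝒜ᵀ) i i' = 0 := by
  by_contra h
  have := schur_stage_banded 𝒜 D σ τ h𝒜 hD i i' h
  omega

/-! ## §3  Read-out counting skeleton -/

/-- Lemma A163-2 (counting skeleton).  If the `b` measured bits determine which element of `C`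
was encoded (some decoder inverts the transcript map on `C`), then `|C| ≤ 2 ^ b`. -/
theorem readout_counting {α : Type*} [DecidableEq α] (b : ℕ) (C : Finset α)
    (t : α → (Fin b → Bool)) (dec : (Fin b → Bool) → α) (h : ∀ c ∈ C, dec (t c) = c) :
    C.card ≤ 2 ^ b := by
  have hinj : Set.InjOn t C := by
    intro x hx y hy hxy
    have := congrArg dec hxy
    rwa [h x hx, h y hy] at this
  calc C.card = (C.image t).card := (Finset.card_image_of_injOn hinj).symm
    _ ≤ Fintype.card (Fin b → Bool) := Finset.card_le_univ _
    _ = 2 ^ b := by simp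

/-! ## §4  Diagonal sandwich -/

section Diag

variable {n : Type*} [Fintype n] [DecidableEq n]

/-- `e_jᵀ M e_j = M j j`. -/
private theorem quad_single (M : Matrix n n ℝ) (j : n) :
    star (Pi.single j (1 : ℝ)) ⬝ᵥ (M *ᵥ Pi.single j 1) = M j j := by
  simp [Matrix.mulVec, dotProduct, Pi.single_apply]

/-- if `T·I − Q` is positive semidefinite then every diagonal entry of `Q` is at most `T` -/
theorem diag_le_of_posSemidef (Q : Matrix n n ℝ) (T : ℝ)
    (h : (T • (1 : Matrix n n ℝ) - Q).PosSemidef) (j : n) : Q j j ≤ T := by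
  have h0 := h.dotProduct_mulVec_nonneg (Pi.single j 1)
  rw [quad_single] at h0
  simp [Matrix.sub_apply, Matrix.smul_apply] at h0
  linarith

/-- if `Q − t·I` is positive semidefinite then every diagonal entry of `Q` is at least `t` -/
theorem le_diag_of_posSemidef (Q : Matrix n n ℝ) (t : ℝ)
    (h : (Q - t • (1 : Matrix n n ℝ)).PosSemidef) (j : n) : t ≤ Q j j := by
  have h0 := h.dotProduct_mulVec_nonneg (Pi.single j 1)
  rw [quad_single] at h0
  simp [Matrix.sub_apply, Matrix.smul_apply] at h0
  linarith

/-- Lemma A163-5 (skeleton): a spectral sandwich `t·I ≼ Q ≼ T·I` with `t > 0` has ratio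
`T / t ≥ Q j j / Q i i` for any two diagonal entries; for the barrier Hessian
`Q = W + μ Σ_j ∇H_j ∇H_jᵀ / H_j²` at an active constraint (`H_j = O(μ)`) the right-hand side is
of order `1/μ`. -/
theorem cond_ge_diag_ratio (Q : Matrix n n ℝ) (t T : ℝ) (ht : 0 < t)
    (hlo : (Q - t • (1 : Matrix n n ℝ)).PosSemidef) (hhi : (T • (1 : Matrix n n ℝ) - Q).PosSemidef)
    (i j : n) (hi : 0 < Q i i) : Q j j / Q i i ≤ T / t := by
  have h1 := le_diag_of_posSemidef Q t hlo i
  have h2 := diag_le_of_posSemidef Q T hhi j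
  have hT : 0 ≤ T := le_trans (le_trans ht.le (le_diag_of_posSemidef Q t hlo j)) h2
  rw [div_le_div_iff₀ hi ht]
  calc Q j j * t ≤ T * t := by nlinarith
    _ ≤ T * Q i i := by nlinarith

end Diag

end Summit.QuantumAdvantage.Dequantization.SchurStage
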